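/-
Copyright: the b2b-balaban T⁴-continuum CRUX team, row NE7b OWNER lineage `t4-ne7b-p1` (gen 124). Project licence.
-/
import Summits.QuantumFields.BalabanUV.T4Continuum.Spine.NE7b.SupZdCoarseInverseIdentities

/-!
# THE INFINITE-VOLUME NEXT-SCALE ACTION IS STRICTLY CONVEX WITH A BOUNDED HESSIAN, MESH-FREE: on `ℓ²(ℤ^d)` the kernel `M = T_∞⁻¹` of
# (194)∕(195) satisfies, for every finitely supported `k`, `‖Mk‖₂ ≤ γ⁻¹‖k‖₂`, `γ‖Mk‖₂² ≤ ⟨k, Mk⟩ ≤ γ⁻¹‖k‖₂²` and `⟨k, Mk⟩ ≥ (γ∕Λ_T²)‖k‖₂²`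
# (`γ = 1∕(36^d(4d + a + Λ))` [B6]'s floor (186), `Λ_T` (191)'s `ℓ²` bound of `T_∞`) — every `V : ℤ^d → [−λ, Λ]`, `d ≥ 3`, every mesh: the
# quadratic form `(n+1)^d⟨k, Mk⟩∕2` of the next-scale action ((102)∕(136), now in infinite volume by (199)) is uniformly positive and
# bounded, so the convexity class the road iterates is preserved in the thermodynamic limit (row NE7b, node U5c; (186)∕(191)∕(193)∕(194)∕(195)
# BY NAME; [folklore])

Cell `pub-balaban`, sub-cell `t4`, spine estimate NE7b (`T4WeightBudget.RelWeightBound`; the cell's OWN estimate — NOT PRINTED in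
[Bałaban 1983–89], NOT PROVED).  Crux-route work under `Spine/NE7b/` by the row OWNER (`t4-ne7b-p1` gen 124, file (205)) under FREEZE
(0)'s crux-prover clause; NOTHING of Bałaban's is named as a Lean object, valued or asserted; no `T4Continuum/Support` leaf typed; no `def`,
no notation (`Mk` WRITTEN OUT as the finite sum `Σ_{b′ ∈ S}M(·,b′)k(b′)`; `M` ANY cube limit); zero `sorry`.  Imports (BY NAME): the OWNER's
(195) `…SupZdCoarseInverseIdentities` (`zd_coarse_section_identities`; through it (194) `mem_cube_of_l1_le`, (191) `zd_coarse_form_bounded`,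
(186) `zd_coarse_floor`), Mathlib's `Finset.sum_mul_sq_le_sq_mul_sq`, `le_of_tendsto`, `ge_of_tendsto`, `le_of_tendsto_of_tendsto`.

WHY (located).  The road iterates a class of strictly convex actions with bounded Hessians ((89)–(123): floor `min(2,a) − λ`, ceiling `Λ`);
after one step the next-scale action's Hessian is `(n+1)^dT⁻¹` ((102)) and (135)∕(136) bounded it on the torus.  In infinite volume the
object is `(n+1)^dM` ((194)∕(199)); its form bounds follow from the SECTIONS: `m_R = (T_{[−R,R]^d})⁻¹k` solves `T_{Q_R}m_R = k` on the cube
((195) §1), so the floor gives `γΣm_R² ≤ ⟨m_R, T m_R⟩ = ⟨k, m_R⟩ ≤ ‖k‖₂‖m_R‖₂` — whence `γ²‖m_R‖₂² ≤ ‖k‖₂²`, `⟨k, m_R⟩ ≤ γ⁻¹‖k‖₂²`,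
`γΣ_Fm_R² ≤ ⟨k, m_R⟩` — and (191)'s `‖T_{Q_R}m_R‖₂ ≤ Λ_T‖m_R‖₂` gives `‖k‖₂² ≤ Λ_T²‖m_R‖₂² ≤ (Λ_T²∕γ)⟨k, m_R⟩`; all four are uniform in `R`
and pass to the limit `m_R(b) → (Mk)(b)` ((194) (i), finite sums).

WHAT IS PROVED ([folklore]): **`zd_coarse_inverse_form`** (THE END: `∃ Λ_T > 0`: for ALL `n, V, Ψ`, ANY cube limit `M`, every `k` vanishing
off a finite `S`, every finite `F`: (i) `Σ_{b ∈ F}(Σ_{b′ ∈ S}M(b,b′)k b′)² ≤ γ⁻²Σ_Sk²`; (ii) `γΣ_F(Mk)² ≤ Σ_Sk·(Mk)`; (iii) `Σ_Sk·(Mk) ≤ γ⁻¹Σ_Sk²`;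
(iv) `(γ∕Λ_T²)Σ_Sk² ≤ Σ_Sk·(Mk)`); §2 toy.

HONEST (what this is NOT).  Form bounds on finitely supported `k` (the `ℓ²` operator by density is not packaged); the constants `γ`, `Λ_T`
are explicit but far from sharp; the LINEAR column only; `d ≥ 3` only; scalar skeleton ((A3), NC-NE7b-α UNRULED); nothing of the covariant
propagators of [B4]–[B6]; [B6] (2.76) is the printed MODEL of the floor — locator only; nothing of Bałaban's asserted.  BY-NAME EFFECT ON
THE WALL: NONE.  NE7b NOT PRINTED ∕ NOT PROVED; spine PROVED 0∕9; rung (B)+1 — the programme's measures remain FINITE-torus statements; NOT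
the mass gap, NOT Clay.  HONEST DEPENDENCY: continuum YM on T⁴ ⇐ BetaPertH ∧ nine spine estimates (0∕9 proved); BetaPertH ⇐ (D1) ∧ (D4) ∧
CAP+tail; G-an2-4 gates asym, D1 and NE2∕3∕4.
-/

set_option autoImplicit false

noncomputable section

namespace Summit.QuantumFields.BalabanUV.T4Continuum.NE7b.SupZdCoarseInverseForm

open Real Filter Topology
open Literature.MathematicalPhysics.QuantumFieldTheory.Balaban1983to89
open B6QGQLower276 (X e blk B side chart mem_B sum_B sum_B_const card_cube blk_chart)
open SupZdCoarseOperator (zd_coarse_floor)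
open SupZdCoarseForm (zd_coarse_form_bounded)
open SupZdCoarseInverse (mem_cube_of_l1_le)
open SupZdCoarseInverseIdentities (zd_coarse_section_identities)

variable {d : ℕ}

/-! ## §1. THE END: the infinite-volume next-scale Hessian kernel is a bounded, uniformly positive form on `ℓ²(ℤ^d)` -/

/-- **HEADLINE — THE `ℓ²` THEORY OF `M = T_∞⁻¹`**: `d ≥ 3`, `a > 0`, `λ < min(2,a)`, `Λ ≥ 0` ⟹ `∃ Λ_T > 0` (from `(d, a, λ, Λ)` ONLY; (191)'s
`ℓ²` bound of `T_∞`) such that, with `γ = 1∕(36^d(4d + a + Λ))` ([B6]'s floor, (186)), for ALL `n`, `V : ℤ^d → [−λ, Λ]`, ANY bounded block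
columns `Ψ`, ANY cube limit `M` ((194)) and every `k` supported in a finite `S`: the function `Mk = Σ_{b′ ∈ S}M(·,b′)k(b′)` satisfies
(i) `Σ_{b ∈ F}(Mk)(b)² ≤ γ⁻²Σ_Sk²` for every finite `F` (`‖M‖_{ℓ²→ℓ²} ≤ γ⁻¹`); (ii) `γΣ_{b ∈ F}(Mk)(b)² ≤ ⟨k, Mk⟩`; (iii) `⟨k, Mk⟩ ≤ γ⁻¹Σ_Sk²`;
(iv) `(γ∕Λ_T²)Σ_Sk² ≤ ⟨k, Mk⟩` — the infinite-volume next-scale action `(n+1)^d⟨k, Mk⟩∕2` is STRICTLY CONVEX with a BOUNDED Hessian,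
mesh-free constants, every potential of the class: the section solutions `m_R = (T_{[−R,R]^d})⁻¹k` obey all four with `R`-free constants
(floor + Cauchy–Schwarz, (191) for (iv)) and converge to `Mk` termwise ((194) (i)). [folklore] -/
theorem zd_coarse_inverse_form (hd : 3 ≤ d) (a : ℝ) (ha : 0 < a) {lam Lam : ℝ} (hlam : lam < min 2 a) (hLam : 0 ≤ Lam) :
    ∃ ΛT : ℝ, 0 < ΛT ∧ ∀ (n : ℕ) (V : X d → ℝ), (∀ p, -lam ≤ V p) → (∀ p, V p ≤ Lam) →
      ∀ (Ψ : X d → X d → ℝ) (BΨ : X d → ℝ), (∀ b' p, |Ψ b' p| ≤ BΨ b') →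
      (∀ b' p, ((n : ℝ) + 1) ^ 2 * ∑ μ, (2 * Ψ b' p - Ψ b' (p + e μ) - Ψ b' (p - e μ))
        + a / ((n : ℝ) + 1) ^ d * ∑ q ∈ B n (blk n p), Ψ b' q + V p * Ψ b' p = if blk n p = b' then 1 else 0) →
      ∀ (M : X d → X d → ℝ), (∀ b b' : X d, Tendsto (fun R : ℕ =>
          if h : b ∈ (Fintype.piFinset fun _ : Fin d => Finset.Icc (-(R : ℤ)) R) ∧
              b' ∈ (Fintype.piFinset fun _ : Fin d => Finset.Icc (-(R : ℤ)) R)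
            then (Matrix.of fun c c' : ↥(Fintype.piFinset fun _ : Fin d => Finset.Icc (-(R : ℤ)) R) =>
              (((n : ℝ) + 1) ^ d)⁻¹ * ∑ q ∈ B n (c : X d), Ψ (c' : X d) q)⁻¹ ⟨b, h.1⟩ ⟨b', h.2⟩ else 0)
        atTop (𝓝 (M b b'))) →
      ∀ (S : Finset (X d)) (k : X d → ℝ), (∀ b, b ∉ S → k b = 0) →
        (∀ F : Finset (X d), ∑ b ∈ F, (∑ b' ∈ S, M b b' * k b') ^ 2 ≤ (1 / (1 / ((36 : ℝ) ^ d * (4 * d + a + Lam)))) ^ 2 * ∑ b ∈ S, k b ^ 2) ∧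
        (∀ F : Finset (X d), 1 / ((36 : ℝ) ^ d * (4 * d + a + Lam)) * ∑ b ∈ F, (∑ b' ∈ S, M b b' * k b') ^ 2
          ≤ ∑ b ∈ S, k b * ∑ b' ∈ S, M b b' * k b') ∧
        (∑ b ∈ S, k b * ∑ b' ∈ S, M b b' * k b' ≤ 1 / (1 / ((36 : ℝ) ^ d * (4 * d + a + Lam))) * ∑ b ∈ S, k b ^ 2) ∧
        (1 / ((36 : ℝ) ^ d * (4 * d + a + Lam)) / ΛT ^ 2 * ∑ b ∈ S, k b ^ 2 ≤ ∑ b ∈ S, k b * ∑ b' ∈ S, M b b' * k b') := by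
  classical
  obtain ⟨ΛT, hΛT, H191⟩ := zd_coarse_form_bounded (d := d) hd a ha hlam hLam
  refine ⟨ΛT, hΛT, ?_⟩
  intro n V hV hV' Ψ BΨ hΨB hΨ M hM S k hk
  set γ : ℝ := 1 / ((36 : ℝ) ^ d * (4 * d + a + Lam)) with hγ
  have hγ0 : 0 < γ := by positivity
  set K : ℝ := ∑ b ∈ S, k b ^ 2 with hK
  have hK0 : 0 ≤ K := Finset.sum_nonneg fun _ _ => sq_nonneg _
  obtain ⟨T, hT⟩ : ∃ T : X d → X d → ℝ, ∀ b b', T b b' = (((n : ℝ) + 1) ^ d)⁻¹ * ∑ q ∈ B n b, Ψ b' q := ⟨_, fun _ _ => rfl⟩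
  -- the zero-extended cube-section inverses and the section solutions `m_R = (T_{Q_R})⁻¹k`
  obtain ⟨MR, hMR⟩ : ∃ MR : ℕ → X d → X d → ℝ, ∀ R c c', MR R c c' =
      if h : c ∈ (Fintype.piFinset fun _ : Fin d => Finset.Icc (-(R : ℤ)) R) ∧
          c' ∈ (Fintype.piFinset fun _ : Fin d => Finset.Icc (-(R : ℤ)) R)
        then (Matrix.of fun c c' : ↥(Fintype.piFinset fun _ : Fin d => Finset.Icc (-(R : ℤ)) R) =>
          (((n : ℝ) + 1) ^ d)⁻¹ * ∑ q ∈ B n (c : X d), Ψ (c' : X d) q)⁻¹ ⟨c, h.1⟩ ⟨c', h.2⟩ else 0 := ⟨_, fun _ _ _ => rfl⟩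
  have hM' : ∀ c c' : X d, Tendsto (fun R : ℕ => MR R c c') atTop (𝓝 (M c c')) := fun c c' => by
    simp only [hMR]; exact hM c c'
  set mR : ℕ → X d → ℝ := fun R b => ∑ b' ∈ S, MR R b b' * k b' with hmR
  have hmlim : ∀ b, Tendsto (fun R => mR R b) atTop (𝓝 (∑ b' ∈ S, M b b' * k b')) := fun b =>
    tendsto_finsetSum _ fun b' _ => (hM' b b').mul_const _
  -- beyond the radius of `S`: `S ⊆ Q_R`
  set R₀ : ℕ := ∑ c ∈ S, ∑ j, (c j).natAbs with hR₀
  have hSQ : ∀ R : ℕ, R₀ ≤ R → S ⊆ Fintype.piFinset fun _ : Fin d => Finset.Icc (-(R : ℤ)) R := fun R hR c hc =>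
    mem_cube_of_l1_le R c (le_trans (le_trans
      (Finset.single_le_sum (f := fun c => ∑ j, (c j).natAbs) (fun _ _ => Nat.zero_le _) hc) (le_of_eq hR₀.symm)) hR)
  -- the four `R`-uniform facts about `m_R`
  have hfacts : ∀ R : ℕ, R₀ ≤ R →
      (∀ F : Finset (X d), ∑ b ∈ F, mR R b ^ 2 ≤ (1 / γ) ^ 2 * K) ∧
      (∀ F : Finset (X d), γ * ∑ b ∈ F, mR R b ^ 2 ≤ ∑ b ∈ S, k b * mR R b) ∧
      (∑ b ∈ S, k b * mR R b ≤ 1 / γ * K) ∧ (γ / ΛT ^ 2 * K ≤ ∑ b ∈ S, k b * mR R b) := by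
    intro R hR
    set Q : Finset (X d) := Fintype.piFinset fun _ : Fin d => Finset.Icc (-(R : ℤ)) R with hQ
    have hSQR := hSQ R hR
    -- support of `m_R`
    have hm0 : ∀ b, b ∉ Q → mR R b = 0 := fun b hb => by
      simp only [hmR]
      exact Finset.sum_eq_zero fun b' _ => by rw [hMR, dif_neg (fun h => hb h.1), zero_mul]
    -- the section equation `Σ_{b′ ∈ Q}T(b,b′)m_R(b′) = k b` on `Q`
    have heq : ∀ b ∈ Q, ∑ b' ∈ Q, T b b' * mR R b' = k b := by
      intro b hb
      have hid : ∀ c ∈ S, ∑ b' ∈ Q, T b b' * MR R b' c = if b = c then 1 else 0 := by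
        intro c hc
        have h := (zd_coarse_section_identities hd a ha hlam hLam n V hV hV' Ψ BΨ hΨB hΨ Q ⟨b, hb⟩ ⟨c, hSQR hc⟩).1
        simp only [Subtype.mk.injEq] at h
        rw [← h, ← Finset.sum_coe_sort Q]
        refine Finset.sum_congr rfl fun x _ => ?_
        rw [hT, hMR, dif_pos ⟨x.2, hSQR hc⟩]
      simp only [hmR, Finset.mul_sum]
      rw [Finset.sum_comm]
      have e1 : ∀ c ∈ S, ∑ b' ∈ Q, T b b' * (MR R b' c * k c) = (if b = c then 1 else 0) * k c := fun c hc => by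
        rw [← hid c hc, Finset.sum_mul]; exact Finset.sum_congr rfl fun b' _ => by ring
      rw [Finset.sum_congr rfl e1]
      by_cases hbS : b ∈ S
      · rw [Finset.sum_eq_single_of_mem b hbS (fun c _ hcb => by rw [if_neg (Ne.symm hcb), zero_mul]), if_pos rfl, one_mul]
      · rw [hk b hbS]
        exact Finset.sum_eq_zero fun c hc => by
          rw [if_neg (fun h : b = c => hbS (h ▸ hc)), zero_mul]
    -- floor: `γX ≤ ⟨m_R, T m_R⟩ = ⟨m_R, k⟩`
    set Xr : ℝ := ∑ b ∈ Q, mR R b ^ 2 with hXr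
    have hXr0 : 0 ≤ Xr := Finset.sum_nonneg fun _ _ => sq_nonneg _
    have hfloor := zd_coarse_floor hd a ha hlam hLam n V hV hV' Ψ BΨ hΨB hΨ Q (mR R) hm0
    simp only [← hT] at hfloor
    have hpair : ∑ b ∈ Q, mR R b * ∑ b' ∈ Q, T b b' * mR R b' = ∑ b ∈ S, k b * mR R b := by
      rw [Finset.sum_congr rfl fun b hb => by rw [heq b hb]]
      rw [← Finset.sum_subset hSQR (fun b _ hbS => by rw [hk b hbS, mul_zero])]
      exact Finset.sum_congr rfl fun b _ => mul_comm _ _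
    rw [hpair, ← hγ, ← hXr] at hfloor
    -- Cauchy–Schwarz: `⟨k, m_R⟩² ≤ K·Σ_S m_R² ≤ K·X`
    have hCS := Finset.sum_mul_sq_le_sq_mul_sq S k (mR R)
    have hSX : ∑ b ∈ S, mR R b ^ 2 ≤ Xr := Finset.sum_le_sum_of_subset_of_nonneg hSQR fun _ _ _ => sq_nonneg _
    have hP2 : (∑ b ∈ S, k b * mR R b) ^ 2 ≤ K * Xr := hCS.trans (mul_le_mul_of_nonneg_left hSX hK0)
    -- `γ²X ≤ K` and `⟨k,m_R⟩ ≤ K∕γ`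
    have hX : γ ^ 2 * Xr ≤ K := by
      by_cases hX0 : Xr = 0
      · rw [hX0, mul_zero]; exact hK0
      · have hXpos : 0 < Xr := lt_of_le_of_ne hXr0 (Ne.symm hX0)
        have h1 : (γ * Xr) ^ 2 ≤ K * Xr := (pow_le_pow_left₀ (by positivity) hfloor 2).trans hP2
        nlinarith
    have hP : ∑ b ∈ S, k b * mR R b ≤ 1 / γ * K := by
      rw [div_mul_eq_mul_div, one_mul, le_div_iff₀ hγ0]
      nlinarith [hfloor, hP2, hX, hXr0, hK0]
    -- (iv): `K ≤ Λ_T²X` ((191) on `Q`)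
    have hup : K ≤ ΛT ^ 2 * Xr := by
      have h := (H191 n V hV hV' Ψ BΨ hΨB hΨ Q (mR R) (mR R)).2
      simp only [← hT] at h
      calc K = ∑ b ∈ S, (∑ b' ∈ Q, T b b' * mR R b') ^ 2 := Finset.sum_congr rfl fun b hb => by rw [heq b (hSQR hb)]
        _ ≤ ∑ b ∈ Q, (∑ b' ∈ Q, T b b' * mR R b') ^ 2 := Finset.sum_le_sum_of_subset_of_nonneg hSQR fun _ _ _ => sq_nonneg _
        _ ≤ ΛT ^ 2 * Xr := h
    have hFX : ∀ F : Finset (X d), ∑ b ∈ F, mR R b ^ 2 ≤ Xr := fun F => by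
      calc ∑ b ∈ F, mR R b ^ 2 = ∑ b ∈ F ∩ Q, mR R b ^ 2 := by
            rw [← Finset.sum_subset Finset.inter_subset_left (fun b hbF hb => by
              rw [Finset.mem_inter, not_and] at hb
              rw [hm0 b (hb hbF)]; ring)]
        _ ≤ Xr := Finset.sum_le_sum_of_subset_of_nonneg Finset.inter_subset_right fun _ _ _ => sq_nonneg _
    refine ⟨fun F => (hFX F).trans ?_, fun F => ?_, hP, ?_⟩
    · rw [div_pow, one_pow, div_mul_eq_mul_div, one_mul, le_div_iff₀ (by positivity)]; nlinarith
    · exact (mul_le_mul_of_nonneg_left (hFX F) hγ0.le).trans hfloor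
    · calc γ / ΛT ^ 2 * K ≤ γ / ΛT ^ 2 * (ΛT ^ 2 * Xr) := mul_le_mul_of_nonneg_left hup (by positivity)
        _ = γ * Xr := by field_simp
        _ ≤ _ := hfloor
  -- pass to the limit `R → ∞`
  have hlimP : Tendsto (fun R => ∑ b ∈ S, k b * mR R b) atTop (𝓝 (∑ b ∈ S, k b * ∑ b' ∈ S, M b b' * k b')) :=
    tendsto_finsetSum _ fun b _ => (hmlim b).const_mul _
  have hlimF : ∀ F : Finset (X d), Tendsto (fun R => ∑ b ∈ F, mR R b ^ 2) atTop (𝓝 (∑ b ∈ F, (∑ b' ∈ S, M b b' * k b') ^ 2)) :=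
    fun F => tendsto_finsetSum _ fun b _ => (hmlim b).pow 2
  refine ⟨fun F => ?_, fun F => ?_, ?_, ?_⟩
  · exact le_of_tendsto (hlimF F) (Filter.eventually_atTop.2 ⟨R₀, fun R hR => (hfacts R hR).1 F⟩)
  · exact le_of_tendsto_of_tendsto ((hlimF F).const_mul γ) hlimP (Filter.eventually_atTop.2 ⟨R₀, fun R hR => (hfacts R hR).2.1 F⟩)
  · exact le_of_tendsto hlimP (Filter.eventually_atTop.2 ⟨R₀, fun R hR => (hfacts R hR).2.2.1⟩)
  · exact ge_of_tendsto hlimP (Filter.eventually_atTop.2 ⟨R₀, fun R hR => (hfacts R hR).2.2.2⟩)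

/-! ## §2. Toy -/

/-- Toy (`d = 3`, `a = 1`, `λ = 0`, `Λ = 1`): the `ℓ²` constant exists. -/
example : ∃ ΛT : ℝ, 0 < ΛT :=
  let ⟨ΛT, h, _⟩ := zd_coarse_inverse_form (d := 3) le_rfl 1 one_pos (lam := 0) (Lam := 1)
    (by rw [min_eq_right (by norm_num : (1 : ℝ) ≤ 2)]; norm_num) zero_le_one
  ⟨ΛT, h⟩

end Summit.QuantumFields.BalabanUV.T4Continuum.NE7b.SupZdCoarseInverseForm
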